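import Mathlib
import Literature.NumberTheory.Transcendental.GammaFields
import Summits.Schanuel.Schanuel.Theorems.RigidCoreAclSubsetLogFreeCoreCaseIILstep
import Summits.Schanuel.Schanuel.Theorems.RigidCoreAclSubsetLogFreeCoreAffineKill
import Summits.Schanuel.Schanuel.Theorems.RigidCoreAclSubsetLogFreeCoreCaseIIShift

/-!
# Case II core, file 2b: level `0` of the core claim
(helper file for the registered stub `stub_caseII_core` of line `eac-extends-core-automorphisms`,
crux stmt-Schanuel-0968 `Summit.Schanuel.Schanuel.Theses.RigidCore.AclSubsetLogFreeCore`)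

**Level `0` of the core claim**: no `θ`-fixed element of `Y 1 ∖ Y 0` — an element of the
A-extension `U` which is algebraic over the Γ-field of `V = X + ℚℓ` and fixed by `θ` is algebraic
over `B = acl (gens X)` by the affine kill lemma (landed `caseII_affineKill`, applied to the powers
`θⁿ`, which translate `ℓ` by `n q τ` and are locally finite on `B`), hence lies in `U ∩ B = X ⊆ V`.
-/

noncomputable section

set_option linter.dupNamespace false

open Set Polynomial
open Literature.ModelTheory.ExponentialFields Literature.ModelTheory.ExponentialFields.ExponentialRing
open Literature.NumberTheory.Transcendental Literature.NumberTheory.Transcendental.GammaField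

namespace Summit.Schanuel.Schanuel.Theorems.RigidCore

namespace CaseIICore

variable {E : Type*} [Field E] [CharZero E] [ExponentialRing E]

/-! ### Level `0`: algebraic over `ℚ(gens (X + ℚℓ))` and fixed ⟹ in `X` -/

omit [ExponentialRing E] in
/-- Algebraic over the subfield `acl s` means in `acl s`. [folklore] -/
theorem mem_acl_of_isAlgebraic_subfield {s : Set E} (L : Subfield E) (hL : (L : Set E) = acl s)
    {z : E} (hz : IsAlgebraic L z) : z ∈ acl s := by
  have hmem : ∀ a, a ∈ L ↔ a ∈ acl s := fun a => by rw [← SetLike.mem_coe, hL]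
  obtain ⟨P, hP0, hcoef, hroot⟩ := (CaseIILstep.isAlgebraic_iff_exists_coeff_mem (T := L)
    (T₀ := acl s) (fun y hy => ⟨⟨y, (hmem y).2 hy⟩, rfl⟩) (fun t => (hmem _).1 t.2)
    (fun _ _ e => Subtype.ext e)).1 hz
  exact CaseIILstep.mem_acl_iff_exists_coeff_mem.2 ⟨P, hP0, hcoef, hroot⟩

/-- **Level `0` of the core claim.** Let `θ` be an exponential automorphism of `E` fixing the
subspace `X ∋ τ` pointwise and shifting the branch `ℓ ↦ ℓ + q • τ` (`q ≠ 0`, `τ ≠ 0`), where `ℓ` is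
transcendental over the base closure `B = acl (gens X)` and `exp ℓ ∈ B`; let `U ⊇ X` be a subspace in
which `X` is A-closed (`U ∩ B = X`). Then every element of `U` which is algebraic over the Γ-field of
`X + ℚℓ` and fixed by `θ` lies in `X`: the iterates `θⁿ` restrict to `B` with finite orbits, fix the
element and move `ℓ` by the pairwise distinct translations `n q τ ∈ B`, so the affine kill lemma
(`caseII_affineKill`) makes it algebraic over `B`, i.e. an element of `U ∩ B = X`. -/
theorem mem_base_of_fixed_of_mem_acl (θ : E ≃+* E) (hθ : ∀ x, θ (exp x) = exp (θ x))
    {X : Submodule ℚ E} (hX : ∀ x ∈ X, θ x = x) {τ : E} (hτX : τ ∈ X) (hτ : τ ≠ 0)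
    {q : ℚ} (hq : q ≠ 0) {ℓ : E} (hθℓ : θ ℓ = ℓ + q • τ)
    (hℓexp : exp ℓ ∈ acl (gens X)) (hℓ : ℓ ∉ acl (gens X))
    {U : Submodule ℚ E} (hXclosed : ∀ u ∈ U, u ∈ acl (gens X) → u ∈ X)
    {a : E} (haU : a ∈ U) (ha : a ∈ acl (gens (X ⊔ Submodule.span ℚ {ℓ}))) (hfix : θ a = a) :
    a ∈ X := by
  classical
  /- the subfields `L = acl (gens X) ≤ R = E` -/
  obtain ⟨L, hLcoe⟩ := CaseIILstep.exists_subfield_coe_eq_acl (gens X)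
  have hL : ∀ z, z ∈ L ↔ z ∈ acl (gens X) := fun z => by rw [← SetLike.mem_coe, hLcoe]
  have hLtop : L ≤ (⊤ : Subfield E) := le_top
  have hXL : ∀ x ∈ X, x ∈ L := fun x hx => (hL x).2 (subset_acl _ (mem_gens_of_mem hx))
  -- `ℓ` transcendental over `L`, `a` algebraic over `L⟮ℓ⟯`
  have hℓtr : Transcendental L ℓ := fun halg => hℓ (mem_acl_of_isAlgebraic_subfield L hLcoe halg)
  set T : IntermediateField L E := IntermediateField.adjoin L ({ℓ} : Set E) with hT
  have hLT : ∀ z ∈ L, z ∈ T := fun z hz => T.algebraMap_mem ⟨z, hz⟩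
  have hℓT : ℓ ∈ T := IntermediateField.subset_adjoin L _ (mem_singleton ℓ)
  have hgensT : gens (X ⊔ Submodule.span ℚ {ℓ}) ⊆ (T : Set E) := by
    have hVT : ∀ y ∈ X ⊔ Submodule.span ℚ {ℓ}, y ∈ T ∧ exp y ∈ T := by
      intro y hy
      obtain ⟨x₀, hx₀, z, hz, rfl⟩ := Submodule.mem_sup.1 hy
      obtain ⟨r, rfl⟩ := Submodule.mem_span_singleton.1 hz
      refine ⟨add_mem (hLT _ (hXL _ hx₀)) ?_, ?_⟩
      · rw [Rat.smul_def]
        exact mul_mem (hLT _ (SubfieldClass.ratCast_mem L r)) hℓT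
      · rw [exp_add]
        exact mul_mem (hLT _ ((hL _).2 (subset_acl _ (exp_mem_gens hx₀))))
          (hLT _ ((hL _).2 (exp_smul_mem_acl r hℓexp)))
    rintro z (hz | ⟨y, hy, rfl⟩)
    · exact (hVT z hz).1
    · exact (hVT y hy).2
  have haT : IsAlgebraic T a := isAlgebraic_of_mem_acl_of_subset T hgensT ha
  /- the iterates `θⁿ` as ring homomorphisms `E = ⊤ → E` -/
  have hiter := fun n : ℕ => exists_ringEquiv_iterate θ hθ n
  choose ψ hψ _hψexp using hiter
  let σ : ℕ → ((⊤ : Subfield E) →+* E) := fun n => (ψ n).toRingHom.comp (Subfield.subtype ⊤)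
  have hσ : ∀ n (z : E) (hz : z ∈ (⊤ : Subfield E)), σ n ⟨z, hz⟩ = θ^[n] z := fun n z hz => hψ n z
  -- `σ n` maps `L` into `L` with finite orbits
  have hσL : ∀ (n : ℕ) (z : E) (hz : z ∈ L), σ n ⟨z, hLtop hz⟩ ∈ L := fun n z hz => by
    rw [hσ, hL]; exact iterate_apply_mem_baseAcl θ hθ hX ((hL z).1 hz) n
  have hfin : ∀ (z : E) (hz : z ∈ L), (range fun n => σ n ⟨z, hLtop hz⟩).Finite := by
    intro z hz
    obtain ⟨p, hp, hpz⟩ := exists_iterate_apply_eq_self_of_mem_baseAcl θ hθ hX ((hL z).1 hz)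
    have heq : (fun n => σ n ⟨z, hLtop hz⟩) = fun n => θ^[n] z := funext fun n => hσ n z _
    rw [heq]
    exact finite_range_iterate_of_periodic θ hp hpz
  have hfixσ : ∀ n, σ n ⟨a, Subfield.mem_top a⟩ = a := fun n => by
    rw [hσ]; exact iterate_apply_eq_self θ hfix n
  -- `σ n` moves `ℓ` by `n q τ`
  have hθτ : θ ((q : E) * τ) = (q : E) * τ := by rw [map_mul, map_ratCast, hX τ hτX]
  have hθℓ' : θ ℓ = ℓ + (q : E) * τ := by rw [hθℓ, Rat.smul_def]
  set v : ℕ → E := fun n => (n : E) * ((q : E) * τ) with hv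
  have hvL : ∀ n, v n ∈ L := fun n =>
    mul_mem (natCast_mem L n) (mul_mem (SubfieldClass.ratCast_mem L q) (hXL τ hτX))
  have hσℓ : ∀ n, σ n ⟨ℓ, Subfield.mem_top ℓ⟩ = 1 * ℓ + v n := fun n => by
    rw [hσ, one_mul, hv, iterate_apply_branch θ hθτ hθℓ' n]
  have hinj : Function.Injective fun n : ℕ => ((1 : E), v n) := by
    intro m n hmn
    have h1 : v m = v n := congrArg Prod.snd hmn
    have hqτ : (q : E) * τ ≠ 0 := mul_ne_zero (Rat.cast_ne_zero.2 hq) hτ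
    have h2 : (m : E) = (n : E) := mul_right_cancel₀ hqτ h1
    exact_mod_cast h2
  /- affine kill -/
  have halg : IsAlgebraic L a :=
    caseII_affineKill L ⊤ hLtop a ℓ (Subfield.mem_top a) (Subfield.mem_top ℓ) hℓtr haT σ hσL hfin
      hfixσ (fun _ => 1) v (fun _ => ⟨L.one_mem, one_ne_zero⟩) hvL hσℓ hinj
  exact hXclosed a haU (mem_acl_of_isAlgebraic_subfield L hLcoe halg)

/-- **Level `0` of the core claim, tower form**: no `θ`-fixed element of `Y 1 ∖ Y 0` (for the
canonical tower of `V = X + ℚℓ ≤ U`). -/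
theorem mem_towerZero_of_fixed (θ : E ≃+* E) (hθ : ∀ x, θ (exp x) = exp (θ x))
    {X : Submodule ℚ E} (hX : ∀ x ∈ X, θ x = x) {τ : E} (hτX : τ ∈ X) (hτ : τ ≠ 0)
    {q : ℚ} (hq : q ≠ 0) {ℓ : E} (hθℓ : θ ℓ = ℓ + q • τ)
    (hℓexp : exp ℓ ∈ acl (gens X)) (hℓ : ℓ ∉ acl (gens X))
    {U : Submodule ℚ E} (hXclosed : ∀ u ∈ U, u ∈ acl (gens X) → u ∈ X)
    {Y : ℕ → Submodule ℚ E} (hY0 : Y 0 = X ⊔ Submodule.span ℚ {ℓ})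
    (hYs : ∀ s, Y (s + 1) = U ⊓ Submodule.span ℚ (acl (gens (Y s))))
    {a : E} (ha : a ∈ Y 1) (hfix : θ a = a) : a ∈ Y 0 := by
  obtain ⟨haU, hacl⟩ := (mem_tower_succ_iff hYs).1 ha
  rw [hY0] at hacl ⊢
  exact Submodule.mem_sup_left
    (mem_base_of_fixed_of_mem_acl θ hθ hX hτX hτ hq hθℓ hℓexp hℓ hXclosed haU hacl hfix)

end CaseIICore

/-! ### Registered helper (crux stub list of stmt-Schanuel-0968) -/

/-- **Registered form of `CaseIICore.mem_towerZero_of_fixed`** (all binders explicit): level `0` of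
the core claim — a `θ`-fixed element of `Y 1` lies in `Y 0 = X + ℚℓ`. -/
theorem caseII_mem_towerZero_of_fixed {E : Type*} [Field E] [CharZero E] [ExponentialRing E]
    (θ : E ≃+* E) (hθ : ∀ x, θ (exp x) = exp (θ x))
    {X : Submodule ℚ E} (hX : ∀ x ∈ X, θ x = x) {τ : E} (hτX : τ ∈ X) (hτ : τ ≠ 0)
    {q : ℚ} (hq : q ≠ 0) {ℓ : E} (hθℓ : θ ℓ = ℓ + q • τ)
    (hℓexp : exp ℓ ∈ acl (gens X)) (hℓ : ℓ ∉ acl (gens X))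
    {U : Submodule ℚ E} (hXclosed : ∀ u ∈ U, u ∈ acl (gens X) → u ∈ X)
    {Y : ℕ → Submodule ℚ E} (hY0 : Y 0 = X ⊔ Submodule.span ℚ {ℓ})
    (hYs : ∀ s, Y (s + 1) = U ⊓ Submodule.span ℚ (acl (gens (Y s))))
    {a : E} (ha : a ∈ Y 1) (hfix : θ a = a) : a ∈ Y 0 :=
  CaseIICore.mem_towerZero_of_fixed θ hθ hX hτX hτ hq hθℓ hℓexp hℓ hXclosed hY0 hYs ha hfix

end Summit.Schanuel.Schanuel.Theorems.RigidCore
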